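import Literature.RingTheory.Henselian.EtaleSectionsFactorization
import Literature.RingTheory.Idempotents.FiniteAlgebraLocalDecomposition
import Mathlib.RingTheory.Artinian.Ring
import Mathlib.RingTheory.Idempotents
import Mathlib.RingTheory.Ideal.GoingUp
import Mathlib.RingTheory.Localization.AtPrime.Basic
import Mathlib.RingTheory.Localization.Away.Lemmas
import HarnessLib

/-!
# Finite algebras over a henselian local ring are products of local rings (Stacks 04GG (1) ⇒ (10), 04GH)

Topic `Literature/RingTheory/Henselian`; namespace `Literature.RingTheory.Henselian`.  PROOF FILE (theorems only; no
definition, no named fact, no instance, no `sorry`).  Cell `hodgecm-mathlib` (D-0151), FLOOR-0 P5a row (S-γ)/(γ1) (the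
generic commutative-algebra input of «specialisation of geometric fibres of a finite flat cover under the reduction map»).
Sequel of `Henselian/EtaleSectionsFactorization` (Stacks 04GG (1) ⇒ (8) ⇒ (4)).  Let `R` be a henselian local ring with
maximal ideal `𝔪` and let `S` be a commutative `R`-algebra; write `𝔪S = 𝔪.map (algebraMap R S)`.

* §1 **`exists_isIdempotentElem_sub_mem`** — idempotents lift along `S → S ⧸ 𝔪S` at integral elements: if `s ∈ S` is integral
  over `R` and `s² ≡ s (mod 𝔪S)` then `e ≡ s (mod 𝔪S)` for an idempotent `e ∈ S`.  Proof (the computation behind Stacks 04GG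
  (4) ⇒ (10)): take a monic `p` with `p(s) = 0` and `p(1) = 0`, split `p̄ = (X-1)^b · q` with `q(1) ≠ 0` over the residue field,
  lift to `p = F·G` with `uF + vG = 1` (04GG (4)), and put `e := (vG)(s)`: then `e(1-e) = (uv·p)(s) = 0`, and modulo `𝔪S` one
  has `e ≡ (vG)(0)(1-s̄) + (vG)(1)s̄ = s̄` since `(vG)(1) ≡ 1`, `F(0)` is a unit and `p(0)(1-s̄) ≡ 0`.
  Corollaries for `S` integral over `R`: `exists_isIdempotentElem_mk_eq` (every idempotent of `S ⧸ 𝔪S` lifts), and the lifts of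
  ORTHOGONAL and of COMPLETE ORTHOGONAL finite families (`exists_orthogonalIdempotents_comp_mk_eq`,
  `exists_completeOrthogonalIdempotents_comp_mk_eq`; Mathlib's nil-ideal induction
  `CompleteOrthogonalIdempotents.lift_of_isNilpotent_ker` re-run with the henselian one-step lemma).
* §2 for `S` module-finite over `R` [Stacks 04GG (1) ⇒ (10), 04GH]: the pure-algebra half «if idempotents lift along
  `S → S ⧸ 𝔪S` then `S` decomposes into local corners» is ★ `Literature/RingTheory/Idempotents/FiniteAlgebraLocalDecomposition`
  (F0P5a-p02: `exists_completeOrthogonalIdempotents_isLocalRing_of_lift`, `isArtinianRing_quotient`, `finite_maximalSpectrum`, the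
  `MaxSpec S ↔ MaxSpec (S ⧸ 𝔪S)` dictionary), IMPORTED BY NAME and fed with §1.  Results: complete orthogonal idempotents `e_𝔫 ∈ S`
  indexed by the maximal ideals `𝔫` of `S` with `e_𝔫 ≡ 1 (mod 𝔫)`, `e_𝔫 ∈ 𝔫'` (`𝔫' ≠ 𝔫`)
  (`exists_completeOrthogonalIdempotents_maximalSpectrum`); each corner `S ⧸ (1 - e_𝔫)` is LOCAL with maximal ideal the image of
  `𝔫` (`isLocalRing_quotient_span_one_sub`) and is the localisation `S_𝔫`; hence
  **`exists_completeOrthogonalIdempotents_isLocalRing`** («`S` is a finite product of local rings», 04GG (10); with Mathlib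
  `CompleteOrthogonalIdempotents.bijective_pi` this is `S ≃ Π_i S ⧸ (1 - e_i)`) and
  **`bijective_pi_algebraMap_localization_atPrime`** («`S → Π_𝔫 S_𝔫` is bijective», 04GH).

HC_CM is proved only modulo the 7 printed citations until rung 0 closes; this file is generic commutative algebra.

## References
* [StacksProject] The Stacks project, Tag 04GG = Algebra, Lemma 10.153.3, (1) ⇒ (10) («any finite `R`-algebra is a finite
  product of local rings») with the printed proof of (9) ⇒ (10) («`S/𝔪S` is Artinian hence has finitely many primes»), and
  Tag 04GH = Lemma 10.153.4 (a finite algebra over a henselian local ring is the product of its localisations at maximal ideals).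
-/

set_option autoImplicit false

noncomputable section

universe u v

open Polynomial IsLocalRing

namespace Literature.RingTheory.Henselian

variable {R : Type u} [CommRing R]

/-! ## §0 Evaluating a polynomial at an idempotent -/

/-- At an idempotent `e`, a polynomial `h` evaluates to `h(0)(1-e) + h(1)e`. [folklore] -/
private theorem aeval_of_isIdempotentElem {S : Type v} [CommRing S] [Algebra R S] {e : S} (he : IsIdempotentElem e)
    (h : R[X]) : aeval e h = algebraMap R S (h.eval 0) * (1 - e) + algebraMap R S (h.eval 1) * e := by
  induction h using Polynomial.induction_on' with
  | add p q hp hq =>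
    rw [map_add, hp, hq, eval_add, eval_add, map_add, map_add]
    ring
  | monomial n c =>
    rw [aeval_monomial, eval_monomial, eval_monomial, one_pow, mul_one]
    cases n with
    | zero => rw [pow_zero, pow_zero, mul_one]; ring
    | succ k => rw [he.pow_succ_eq, zero_pow (Nat.succ_ne_zero k), mul_zero, map_zero, zero_mul, zero_add]

variable [HenselianLocalRing R]

/-! ## §1 Lifting idempotents along `S → S ⧸ 𝔪S` -/

/-- **Idempotents lift modulo `𝔪S` at integral elements over a henselian local ring**: if `s ∈ S` is integral over the
henselian local ring `R` and `s² - s ∈ 𝔪S`, then there is an idempotent `e ∈ S` with `e - s ∈ 𝔪S` (indeed `e ∈ R[s]`).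
This is the computation by which [Stacks 04GG] passes from lifted factorisations (4) to product decompositions (10): with
`p` monic, `p(s) = 0 = p(1)`, `p̄ = (X-1)^b q`, `q(1) ≠ 0`, lifted to `p = FG`, `uF + vG = 1`, the element `e = (vG)(s)` works.
[cite: StacksProject, Tag 04GG (4)⇒(10)] -/
theorem exists_isIdempotentElem_sub_mem {S : Type v} [CommRing S] [Algebra R S] (s : S) (hs : IsIntegral R s)
    (h : s * s - s ∈ (maximalIdeal R).map (algebraMap R S)) :
    ∃ e : S, IsIdempotentElem e ∧ e - s ∈ (maximalIdeal R).map (algebraMap R S) := by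
  classical
  set I := (maximalIdeal R).map (algebraMap R S) with hI
  -- a monic equation `p(s) = 0` with `p(1) = 0`
  obtain ⟨p₀, hp₀, hp₀s⟩ := hs
  set p : R[X] := p₀ * (X - C 1) with hpdef
  have hp : p.Monic := hp₀.mul (monic_X_sub_C 1)
  have hps : aeval s p = 0 := by
    rw [hpdef, map_mul, Polynomial.aeval_def, hp₀s, zero_mul]
  have hp1 : p.eval 1 = 0 := by rw [hpdef, eval_mul, eval_sub, eval_X, eval_C, sub_self, mul_zero]
  -- over the residue field: `p̄ = (X - 1)^b · q` with `q(1) ≠ 0`, `b > 0`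
  set pb := p.map (residue R) with hpb
  have hpb0 : pb ≠ 0 := (hp.map (residue R)).ne_zero
  have hroot : pb.IsRoot 1 := by rw [IsRoot.def, hpb, eval_one_map, hp1, map_zero]
  set b := pb.rootMultiplicity 1 with hb
  have hbpos : 0 < b := (rootMultiplicity_pos hpb0).2 hroot
  set q := pb /ₘ (X - C 1) ^ b with hq
  have hpq : (X - C 1) ^ b * q = pb := pow_mul_divByMonic_rootMultiplicity_eq pb 1
  have hq1 : q.eval 1 ≠ 0 := eval_divByMonic_pow_rootMultiplicity_ne_zero 1 hpb0
  have hf₀ : ((X - C (1 : ResidueField R)) ^ b).Monic := (monic_X_sub_C 1).pow b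
  have hqm : q.Monic := hf₀.of_mul_monic_left (hpq ▸ hp.map (residue R))
  have hcop : IsCoprime ((X - C (1 : ResidueField R)) ^ b) q := by
    refine IsCoprime.pow_left ((irreducible_X_sub_C (1 : ResidueField R)).coprime_iff_not_dvd.2 fun hdvd => ?_)
    exact hq1 (dvd_iff_isRoot.1 hdvd)
  -- lift the factorisation (04GG (4)) and a Bézout relation
  obtain ⟨F, G, -, -, hpFG, hcFG, hFf, -⟩ :=
    exists_monic_mul_eq_of_isCoprime_residue p hp _ q hf₀ hqm hpq.symm hcop
  obtain ⟨u, v, huv⟩ := hcFG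
  -- the idempotent
  refine ⟨aeval s (v * G), ?_, ?_⟩
  · have h1e' : aeval s (u * F) + aeval s (v * G) = 1 := by rw [← map_add, huv, map_one]
    have h1e : 1 - aeval s (v * G) = aeval s (u * F) := by rw [← h1e']; ring
    have hzero : aeval s (v * G) * (1 - aeval s (v * G)) = 0 := by
      rw [h1e, ← map_mul, show v * G * (u * F) = (v * u) * (F * G) by ring, ← hpFG, map_mul, hps, mul_zero]
    rw [IsIdempotentElem, ← sub_eq_zero, ← neg_sub, neg_eq_zero, ← mul_one_sub, hzero]
  · -- compare in `S ⧸ 𝔪S`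
    let π : S →ₐ[R] S ⧸ I := Ideal.Quotient.mkₐ R I
    have hπalg : ∀ r ∈ maximalIdeal R, algebraMap R (S ⧸ I) r = 0 := fun r hr => by
      rw [IsScalarTower.algebraMap_apply R S (S ⧸ I), Ideal.Quotient.algebraMap_eq, Ideal.Quotient.eq_zero_iff_mem]
      exact Ideal.mem_map_of_mem _ hr
    have hē : IsIdempotentElem (π s) := by
      rw [IsIdempotentElem, ← map_mul]
      exact ((Ideal.Quotient.mk_eq_mk_iff_sub_mem _ _).2 h)
    -- `(vG)(1) ≡ 1`
    have hvG1 : algebraMap R (S ⧸ I) ((v * G).eval 1) = 1 := by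
      have h1 : u.eval 1 * F.eval 1 + (v * G).eval 1 = 1 := by
        have := congrArg (eval 1) huv
        rwa [eval_add, eval_mul, eval_one] at this
      have hF1 : F.eval 1 ∈ maximalIdeal R := by
        rw [← residue_eq_zero_iff, ← eval_one_map, hFf, eval_pow, eval_sub, eval_X, eval_C, sub_self,
          zero_pow hbpos.ne']
      have h2 : (v * G).eval 1 = 1 - u.eval 1 * F.eval 1 := by linear_combination h1
      rw [h2, map_sub, map_one, map_mul, hπalg _ hF1, mul_zero, sub_zero]
    -- `G(0)(1 - s̄) ≡ 0`
    have hG0 : algebraMap R (S ⧸ I) (G.eval 0) * (1 - π s) = 0 := by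
      have hF0 : IsUnit (algebraMap R (S ⧸ I) (F.eval 0)) := by
        refine IsUnit.map _ (?_ : IsUnit (F.eval 0))
        rw [← not_not (a := IsUnit (F.eval 0)), ← mem_nonunits_iff, ← mem_maximalIdeal, ← residue_eq_zero_iff,
          ← eval_zero_map, hFf, eval_pow, eval_sub, eval_X, eval_C, zero_sub]
        exact pow_ne_zero _ (neg_ne_zero.2 one_ne_zero)
      have hp0 : algebraMap R (S ⧸ I) (p.eval 0) * (1 - π s) = 0 := by
        have h0 : aeval (π s) p = 0 := by rw [aeval_algHom_apply, hps, map_zero]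
        rw [aeval_of_isIdempotentElem hē] at h0
        have := congrArg (· * (1 - π s)) h0
        simpa only [zero_mul, add_mul, mul_assoc, hē.one_sub.eq, hē.mul_one_sub_self, mul_zero, add_zero] using this
      rw [hpFG, eval_mul, map_mul, mul_assoc] at hp0
      exact hF0.mul_right_eq_zero.1 hp0
    -- assemble
    rw [← Ideal.Quotient.mk_eq_mk_iff_sub_mem]
    change π (aeval s (v * G)) = π s
    rw [← aeval_algHom_apply, aeval_of_isIdempotentElem hē, hvG1, one_mul, eval_mul, map_mul, mul_assoc, hG0, mul_zero,
      zero_add]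

/-- **Every idempotent of `S ⧸ 𝔪S` lifts to an idempotent of `S`**, for `S` integral over the henselian local ring `R`.
[cite: StacksProject, Tag 04GG (4)⇒(10)] -/
theorem exists_isIdempotentElem_mk_eq {S : Type v} [CommRing S] [Algebra R S] [Algebra.IsIntegral R S]
    (ē : S ⧸ (maximalIdeal R).map (algebraMap R S)) (hē : IsIdempotentElem ē) :
    ∃ e : S, IsIdempotentElem e ∧ Ideal.Quotient.mk _ e = ē := by
  obtain ⟨s, rfl⟩ := Ideal.Quotient.mk_surjective ē
  have h : s * s - s ∈ (maximalIdeal R).map (algebraMap R S) := by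
    rw [← Ideal.Quotient.mk_eq_mk_iff_sub_mem, map_mul]
    exact hē.eq
  obtain ⟨e, he, hes⟩ := exists_isIdempotentElem_sub_mem s (Algebra.IsIntegral.isIntegral s) h
  exact ⟨e, he, (Ideal.Quotient.mk_eq_mk_iff_sub_mem _ _).2 hes⟩

/-- One-step lemma for lifting orthogonal families: an idempotent of `S ⧸ 𝔪S` orthogonal to the image of an idempotent
`e₁ ∈ S` lifts to an idempotent of `S` orthogonal to `e₁` (lift arbitrarily, then multiply by `1 - e₁`).
[cite: StacksProject, Tag 04GG (4)⇒(10)] -/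
theorem exists_isIdempotentElem_mk_eq_mul_eq_zero {S : Type v} [CommRing S] [Algebra R S] [Algebra.IsIntegral R S]
    (ē : S ⧸ (maximalIdeal R).map (algebraMap R S)) (hē : IsIdempotentElem ē) (e₁ : S) (he₁ : IsIdempotentElem e₁)
    (h₁ : ē * Ideal.Quotient.mk _ e₁ = 0) :
    ∃ e : S, IsIdempotentElem e ∧ Ideal.Quotient.mk _ e = ē ∧ e * e₁ = 0 ∧ e₁ * e = 0 := by
  obtain ⟨e, he, rfl⟩ := exists_isIdempotentElem_mk_eq ē hē
  refine ⟨e * (1 - e₁), he.mul he₁.one_sub, ?_, ?_, ?_⟩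
  · rw [map_mul, map_sub, map_one, mul_sub, mul_one, h₁, sub_zero]
  · rw [mul_assoc, he₁.one_sub_mul_self, mul_zero]
  · rw [mul_comm, mul_assoc, he₁.one_sub_mul_self, mul_zero]

/-- Orthogonal families indexed by `Fin n` lift (induction step of Mathlib's `OrthogonalIdempotents.lift_of_isNilpotent_ker`,
with the henselian one-step lemma). [cite: StacksProject, Tag 04GG (4)⇒(10)] -/
private theorem exists_orthogonalIdempotents_comp_mk_eq_aux {S : Type v} [CommRing S] [Algebra R S]
    [Algebra.IsIntegral R S] {n : ℕ} {ē : Fin n → S ⧸ (maximalIdeal R).map (algebraMap R S)}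
    (hē : OrthogonalIdempotents ē) :
    ∃ e : Fin n → S, OrthogonalIdempotents e ∧ Ideal.Quotient.mk _ ∘ e = ē := by
  classical
  induction n with
  | zero => exact ⟨0, ⟨finZeroElim, Subsingleton.pairwise⟩, funext finZeroElim⟩
  | succ n IH =>
    obtain ⟨e', h₁, h₂⟩ := IH (hē.embedding (Fin.succEmb n))
    have h₂' : ∀ i, Ideal.Quotient.mk _ (e' i) = ē i.succ := fun i => congr_fun h₂ i
    have horth : ē 0 * Ideal.Quotient.mk _ (∑ i, e' i) = 0 := by
      rw [map_sum, Finset.mul_sum]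
      refine Finset.sum_eq_zero fun i _ => ?_
      rw [h₂']
      exact hē.ortho (Fin.succ_ne_zero i).symm
    obtain ⟨e₀, h₃, h₄, h₅, h₆⟩ :=
      exists_isIdempotentElem_mk_eq_mul_eq_zero (ē 0) (hē.idem 0) _ h₁.isIdempotentElem_sum horth
    refine ⟨_, (h₁.option _ h₃ h₅ h₆).embedding (finSuccEquiv n).toEmbedding, funext fun i => ?_⟩
    obtain ⟨_ | i, rfl⟩ := (finSuccEquiv n).symm.surjective i <;> simp [*]

/-- **Finite orthogonal families of idempotents lift along `S → S ⧸ 𝔪S`** for `S` integral over a henselian local ring.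
[cite: StacksProject, Tag 04GG (4)⇒(10)] -/
theorem exists_orthogonalIdempotents_comp_mk_eq {S : Type v} [CommRing S] [Algebra R S] [Algebra.IsIntegral R S]
    {ι : Type*} [Finite ι] {ē : ι → S ⧸ (maximalIdeal R).map (algebraMap R S)} (hē : OrthogonalIdempotents ē) :
    ∃ e : ι → S, OrthogonalIdempotents e ∧ Ideal.Quotient.mk _ ∘ e = ē := by
  cases nonempty_fintype ι
  obtain ⟨e', h₁, h₂⟩ := exists_orthogonalIdempotents_comp_mk_eq_aux (R := R)
    (hē.embedding (Fintype.equivFin ι).symm.toEmbedding)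
  refine ⟨_, h₁.embedding (Fintype.equivFin ι).toEmbedding, ?_⟩
  ext x
  simpa using congr_fun h₂ (Fintype.equivFin ι x)

/-- If `𝔪S = S` for `S` integral over the local ring `R`, then `S = 0` (a maximal ideal of `S` would lie over `𝔪`).
[cite: StacksProject, Tag 04GG (9)⇒(10), proof] -/
theorem subsingleton_of_map_maximalIdeal_eq_top {S : Type v} [CommRing S] [Algebra R S] [Algebra.IsIntegral R S]
    (h : (maximalIdeal R).map (algebraMap R S) = ⊤) : Subsingleton S := by
  by_contra hS
  rw [not_subsingleton_iff_nontrivial] at hS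
  obtain ⟨𝔫, h𝔫⟩ := Ideal.exists_maximal S
  have hcomap : (𝔫.comap (algebraMap R S)) = maximalIdeal R :=
    IsLocalRing.eq_maximalIdeal (Ideal.isMaximal_comap_of_isIntegral_of_isMaximal 𝔫)
  have hle : (maximalIdeal R).map (algebraMap R S) ≤ 𝔫 := Ideal.map_le_iff_le_comap.2 hcomap.ge
  exact h𝔫.ne_top (top_le_iff.1 (h ▸ hle))

/-- **Finite complete orthogonal families of idempotents lift along `S → S ⧸ 𝔪S`** for `S` integral over a henselian
local ring (lift all but one as an orthogonal family, complete by `1 - Σ`). [cite: StacksProject, Tag 04GG (4)⇒(10)] -/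
theorem exists_completeOrthogonalIdempotents_comp_mk_eq {S : Type v} [CommRing S] [Algebra R S]
    [Algebra.IsIntegral R S] {ι : Type*} [Fintype ι] {ē : ι → S ⧸ (maximalIdeal R).map (algebraMap R S)}
    (hē : CompleteOrthogonalIdempotents ē) :
    ∃ e : ι → S, CompleteOrthogonalIdempotents e ∧ Ideal.Quotient.mk _ ∘ e = ē := by
  classical
  -- reduce to `Fin n`
  suffices key : ∀ {n : ℕ} {ē : Fin n → S ⧸ (maximalIdeal R).map (algebraMap R S)},
      CompleteOrthogonalIdempotents ē → ∃ e : Fin n → S, CompleteOrthogonalIdempotents e ∧ Ideal.Quotient.mk _ ∘ e = ē by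
    obtain ⟨e', h₁, h₂⟩ := key ((CompleteOrthogonalIdempotents.equiv (Fintype.equivFin ι).symm).mpr hē)
    refine ⟨_, (CompleteOrthogonalIdempotents.equiv (Fintype.equivFin ι)).mpr h₁, ?_⟩
    ext x
    simpa using congr_fun h₂ (Fintype.equivFin ι x)
  intro n
  cases n with
  | zero =>
    intro ē hē
    -- the empty family is complete iff the ring is trivial
    have h01 : (0 : S ⧸ (maximalIdeal R).map (algebraMap R S)) = 1 := by simpa using hē.complete
    have htop := (Ideal.Quotient.zero_eq_one_iff).1 h01
    haveI := subsingleton_of_map_maximalIdeal_eq_top htop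
    exact ⟨finZeroElim, ⟨⟨finZeroElim, Subsingleton.pairwise⟩, Subsingleton.elim _ _⟩, funext finZeroElim⟩
  | succ n =>
    intro ē hē
    obtain ⟨e', h₁, h₂⟩ := exists_orthogonalIdempotents_comp_mk_eq_aux (R := R) hē.toOrthogonalIdempotents
    refine ⟨_, (CompleteOrthogonalIdempotents.equiv (finSuccEquiv n)).mpr
      (CompleteOrthogonalIdempotents.option (h₁.embedding (Fin.succEmb _))), funext fun i => ?_⟩
    have he'' : ∀ i, Ideal.Quotient.mk _ (e' i) = ē i := fun i => congr_fun h₂ i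
    cases i using Fin.cases with
    | zero => simp [he'', Fin.sum_univ_succ, ← hē.complete]
    | succ i => simp [he'']

/-! ## §2 Finite algebras over a henselian local ring: the product decomposition

The pure-algebra half — «if idempotents lift along `A → A ⧸ 𝔪A` then `A` decomposes into local corners» — is
`Literature/RingTheory/Idempotents/FiniteAlgebraLocalDecomposition` (F0P5a-p02), consumed BY NAME through its hypothesis `hlift`,
which §1 supplies for every module-finite `S` over a henselian `R`. -/

/-- **Complete orthogonal idempotents adapted to the maximal ideals** [Stacks 04GG (1) ⇒ (10)]: for `S` module-finite over the
henselian local ring `R` there are complete orthogonal idempotents `e_𝔫 ∈ S`, indexed by the maximal ideals `𝔫` of `S`, with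
`e_𝔫 ≡ 1 (mod 𝔫)` and `e_𝔫 ∈ 𝔫'` for `𝔫' ≠ 𝔫` (★ `Idempotents.exists_completeOrthogonalIdempotents_isLocalRing_of_lift` fed with
§1, re-indexed along `MaxSpec S ≃ MaxSpec (S ⧸ 𝔪S)`). [cite: StacksProject, Tag 04GG (1)⇒(10)] -/
theorem exists_completeOrthogonalIdempotents_maximalSpectrum (R : Type u) [CommRing R] [HenselianLocalRing R]
    {S : Type v} [CommRing S] [Algebra R S] [Module.Finite R S] [Fintype (MaximalSpectrum S)] :
    ∃ e : MaximalSpectrum S → S, CompleteOrthogonalIdempotents e ∧ (∀ 𝔫, e 𝔫 - 1 ∈ 𝔫.asIdeal) ∧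
      ∀ 𝔫 𝔫', 𝔫 ≠ 𝔫' → e 𝔫 ∈ 𝔫'.asIdeal := by
  classical
  set I := (maximalIdeal R).map (algebraMap R S) with hI
  haveI := Literature.RingTheory.Idempotents.isArtinianRing_quotient (R := R) (A := S)
  haveI : Fintype (MaximalSpectrum (S ⧸ I)) := Fintype.ofFinite _
  haveI : Algebra.IsIntegral R S := Algebra.IsIntegral.of_finite R S
  obtain ⟨e, he, he1, he0, -⟩ :=
    Literature.RingTheory.Idempotents.exists_completeOrthogonalIdempotents_isLocalRing_of_lift (R := R) (A := S)
      fun ē hē => exists_isIdempotentElem_mk_eq (R := R) ē hē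
  -- the bijection `MaxSpec S ≃ MaxSpec (S ⧸ 𝔪S)`
  let Φ : MaximalSpectrum S → MaximalSpectrum (S ⧸ I) := fun 𝔫 =>
    ⟨𝔫.asIdeal.map (Ideal.Quotient.mk I), Literature.RingTheory.Idempotents.isMaximal_map_mk (R := R) 𝔫.asIdeal 𝔫.isMaximal⟩
  have hΦ : ∀ 𝔫, (Φ 𝔫).asIdeal.comap (Ideal.Quotient.mk I) = 𝔫.asIdeal := fun 𝔫 =>
    Literature.RingTheory.Idempotents.comap_map_mk (R := R) 𝔫.asIdeal 𝔫.isMaximal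
  have hΦinj : Function.Injective Φ := fun 𝔫 𝔫' h => MaximalSpectrum.ext (by rw [← hΦ 𝔫, ← hΦ 𝔫', h])
  have hΦsurj : Function.Surjective Φ := fun J =>
    ⟨⟨J.asIdeal.comap (Ideal.Quotient.mk I), Literature.RingTheory.Idempotents.isMaximal_comap_mk (R := R) J.asIdeal J.isMaximal⟩,
      MaximalSpectrum.ext (Literature.RingTheory.Idempotents.map_comap_mk (R := R) J.asIdeal)⟩
  let Ψ : MaximalSpectrum S ≃ MaximalSpectrum (S ⧸ I) := Equiv.ofBijective Φ ⟨hΦinj, hΦsurj⟩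
  refine ⟨e ∘ Ψ, (CompleteOrthogonalIdempotents.equiv Ψ).mpr he, fun 𝔫 => ?_, fun 𝔫 𝔫' h => ?_⟩
  · have h1 : 1 - e (Ψ 𝔫) ∈ 𝔫.asIdeal := by rw [← hΦ 𝔫]; exact he1 (Ψ 𝔫)
    have := 𝔫.asIdeal.neg_mem h1
    rwa [neg_sub] at this
  · rw [Function.comp_apply, ← hΦ 𝔫']
    exact he0 _ _ fun h' => h (Ψ.injective h')

/-- If an element `e₀` of a commutative ring is `≡ 1` modulo one maximal ideal `𝔫₀` and lies in every other maximal ideal,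
then `S ⧸ (1 - e₀)` is a local ring with maximal ideal the image of `𝔫₀`. [cite: StacksProject, Tag 04GG (9)⇒(10), proof] -/
theorem isLocalRing_quotient_span_one_sub {S : Type v} [CommRing S] (e₀ : S) (𝔫₀ : Ideal S) [h𝔫₀ : 𝔫₀.IsMaximal]
    (h₀ : e₀ - 1 ∈ 𝔫₀)
    (h : ∀ 𝔫 : Ideal S, 𝔫.IsMaximal → 𝔫 ≠ 𝔫₀ → e₀ ∈ 𝔫) :
    IsLocalRing (S ⧸ Ideal.span {1 - e₀}) ∧
      (𝔫₀.map (Ideal.Quotient.mk (Ideal.span {1 - e₀}))).IsMaximal := by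
  set mk := Ideal.Quotient.mk (Ideal.span {1 - e₀}) with hmk
  have hker : Ideal.span {1 - e₀} ≤ 𝔫₀ := by
    rw [Ideal.span_le, Set.singleton_subset_iff]
    have := 𝔫₀.neg_mem h₀
    rwa [neg_sub] at this
  have hcm : (𝔫₀.map mk).comap mk = 𝔫₀ := by
    rw [Ideal.comap_map_of_surjective _ Ideal.Quotient.mk_surjective, ← RingHom.ker_eq_comap_bot, Ideal.mk_ker,
      sup_eq_left.2 hker]
  have hmax : (𝔫₀.map mk).IsMaximal := by
    refine (Ideal.map_eq_top_or_isMaximal_of_surjective _ Ideal.Quotient.mk_surjective h𝔫₀).resolve_left fun htop =>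
      h𝔫₀.ne_top ?_
    rw [← hcm, htop, Ideal.comap_top]
  refine ⟨IsLocalRing.of_unique_max_ideal ⟨𝔫₀.map mk, hmax, fun M hM => ?_⟩, hmax⟩
  have hcM : (M.comap mk).IsMaximal := Ideal.comap_isMaximal_of_surjective _ Ideal.Quotient.mk_surjective
  have h1e : 1 - e₀ ∈ M.comap mk := by
    rw [Ideal.mem_comap, hmk, Ideal.Quotient.eq_zero_iff_mem.2 (Ideal.subset_span (Set.mem_singleton (1 - e₀)))]
    exact M.zero_mem
  have hM₀ : M.comap mk = 𝔫₀ := by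
    by_contra hne
    have he₀ : e₀ ∈ M.comap mk := h _ hcM hne
    have : (1 : S) ∈ M.comap mk := by
      have := (M.comap mk).add_mem h1e he₀
      rwa [sub_add_cancel] at this
    exact hcM.ne_top ((Ideal.eq_top_iff_one _).2 this)
  rw [← Ideal.map_comap_of_surjective mk Ideal.Quotient.mk_surjective M, hM₀]

/-- **A finite algebra over a henselian local ring is a finite product of local rings** [Stacks 04GG (1) ⇒ (10)]: there are
complete orthogonal idempotents `e_1, …, e_n ∈ S` with every `S ⧸ (1 - e_i)` local; by Mathlib's
`CompleteOrthogonalIdempotents.bijective_pi`, `S ≃ Π_i S ⧸ (1 - e_i)`. [cite: StacksProject, Tag 04GG (1)⇒(10)] -/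
theorem exists_completeOrthogonalIdempotents_isLocalRing (R : Type u) [CommRing R] [HenselianLocalRing R]
    {S : Type v} [CommRing S] [Algebra R S] [Module.Finite R S] :
    ∃ (n : ℕ) (e : Fin n → S), CompleteOrthogonalIdempotents e ∧ ∀ i, IsLocalRing (S ⧸ Ideal.span {1 - e i}) := by
  classical
  haveI : Fintype (MaximalSpectrum S) :=
    @Fintype.ofFinite _ (Literature.RingTheory.Idempotents.finite_maximalSpectrum (R := R) (A := S))
  obtain ⟨e, he, he1, he0⟩ := exists_completeOrthogonalIdempotents_maximalSpectrum R (S := S)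
  refine ⟨Fintype.card (MaximalSpectrum S), e ∘ (Fintype.equivFin (MaximalSpectrum S)).symm,
    (CompleteOrthogonalIdempotents.equiv (Fintype.equivFin (MaximalSpectrum S)).symm).mpr he, fun i => ?_⟩
  set 𝔫 := (Fintype.equivFin (MaximalSpectrum S)).symm i
  haveI := 𝔫.isMaximal
  exact (isLocalRing_quotient_span_one_sub (e 𝔫) 𝔫.asIdeal (he1 𝔫)
    fun 𝔫' h𝔫' hne => he0 𝔫 ⟨𝔫', h𝔫'⟩ (fun h' => hne (congrArg MaximalSpectrum.asIdeal h').symm)).1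

/-- **A finite algebra over a henselian local ring is the product of its localisations at its (finitely many) maximal
ideals** [Stacks 04GH]: the canonical map `S → Π_𝔫 S_𝔫` is bijective.  (Each `S ⧸ (1 - e_𝔫)` is local and is the
localisation of `S` at `𝔫`.) [cite: StacksProject, Tag 04GH] [cite: StacksProject, Tag 04GG (1)⇒(10)] -/
theorem bijective_pi_algebraMap_localization_atPrime (R : Type u) [CommRing R] [HenselianLocalRing R]
    {S : Type v} [CommRing S] [Algebra R S] [Module.Finite R S] :
    Function.Bijective (RingHom.pi fun 𝔫 : MaximalSpectrum S => algebraMap S (Localization.AtPrime 𝔫.asIdeal)) := by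
  classical
  haveI : Fintype (MaximalSpectrum S) :=
    @Fintype.ofFinite _ (Literature.RingTheory.Idempotents.finite_maximalSpectrum (R := R) (A := S))
  obtain ⟨e, he, he1, he0⟩ := exists_completeOrthogonalIdempotents_maximalSpectrum R (S := S)
  -- each `S ⧸ (1 - e 𝔫)` is the localisation at `𝔫`
  have key : ∀ 𝔫 : MaximalSpectrum S,
      IsLocalization 𝔫.asIdeal.primeCompl (S ⧸ Ideal.span {1 - e 𝔫}) := fun 𝔫 => by
    haveI := 𝔫.isMaximal
    haveI : IsLocalization.Away (e 𝔫) (S ⧸ Ideal.span {1 - e 𝔫}) :=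
      IsLocalization.Away.quotient_of_isIdempotentElem (he.idem 𝔫)
    obtain ⟨hloc, hmax⟩ := isLocalRing_quotient_span_one_sub (e 𝔫) 𝔫.asIdeal (he1 𝔫)
      fun 𝔫' h𝔫' hne => he0 𝔫 ⟨𝔫', h𝔫'⟩ (fun h' => hne (congrArg MaximalSpectrum.asIdeal h').symm)
    haveI := hloc
    have hne : e 𝔫 ∉ 𝔫.asIdeal := fun hmem => 𝔫.isMaximal.ne_top ((Ideal.eq_top_iff_one _).2 (by
      have := 𝔫.asIdeal.sub_mem hmem (he1 𝔫); rwa [sub_sub_cancel] at this))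
    refine IsLocalization.of_le (Submonoid.powers (e 𝔫)) 𝔫.asIdeal.primeCompl ?_ fun r hr => ?_
    · rw [Submonoid.powers_le]
      exact hne
    · -- `r ∉ 𝔫` maps outside the maximal ideal of the local ring `S ⧸ (1 - e 𝔫)`
      rw [Ideal.Quotient.algebraMap_eq]
      by_contra hunit
      have hmem : Ideal.Quotient.mk (Ideal.span {1 - e 𝔫}) r ∈ maximalIdeal (S ⧸ Ideal.span {1 - e 𝔫}) := by
        rw [IsLocalRing.mem_maximalIdeal, mem_nonunits_iff]; exact hunit
      rw [← IsLocalRing.eq_maximalIdeal hmax, ← Ideal.mem_comap, Ideal.comap_map_of_surjective _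
        Ideal.Quotient.mk_surjective, ← RingHom.ker_eq_comap_bot, Ideal.mk_ker, sup_eq_left.2 ?_] at hmem
      · exact hr hmem
      · rw [Ideal.span_le, Set.singleton_subset_iff]
        have := 𝔫.asIdeal.neg_mem (he1 𝔫)
        rwa [neg_sub] at this
  -- compare with the bijection `S ≃ Π S ⧸ (1 - e 𝔫)` of Mathlib
  let θ : ∀ 𝔫 : MaximalSpectrum S, (S ⧸ Ideal.span {1 - e 𝔫}) ≃ₐ[S] Localization.AtPrime 𝔫.asIdeal := fun 𝔫 =>
    @IsLocalization.algEquiv S _ 𝔫.asIdeal.primeCompl (S ⧸ Ideal.span {1 - e 𝔫}) _ _ (key 𝔫)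
      (Localization.AtPrime 𝔫.asIdeal) _ _ _
  let Θ : (∀ 𝔫 : MaximalSpectrum S, S ⧸ Ideal.span {1 - e 𝔫}) ≃
      ∀ 𝔫 : MaximalSpectrum S, Localization.AtPrime 𝔫.asIdeal :=
    Equiv.piCongrRight fun 𝔫 => (θ 𝔫).toEquiv
  have hfac : (RingHom.pi fun 𝔫 : MaximalSpectrum S => algebraMap S (Localization.AtPrime 𝔫.asIdeal)) =
      Θ ∘ (RingHom.pi fun 𝔫 => Ideal.Quotient.mk (Ideal.span {1 - e 𝔫})) := by
    funext x; funext 𝔫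
    change algebraMap S (Localization.AtPrime 𝔫.asIdeal) x = θ 𝔫 (algebraMap S (S ⧸ Ideal.span {1 - e 𝔫}) x)
    rw [AlgEquiv.commutes]
  rw [hfac]
  exact Θ.bijective.comp he.bijective_pi


end Literature.RingTheory.Henselian

end
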